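import Literature.Probability.Percolation.LonePortSumGeneral
import Literature.Probability.Percolation.KozmaNitzanPreFKG
import Literature.Probability.Percolation.LonelyClusterExchange
import HarnessLib

/-!
# `NoHeavyLowerTail` (stmt-CriticalPhenomena-4575) — hull-port line: tools for SL(3,1) (two BHK-1.3 steps)

Support file (prover `prim-ineq-prove-5`; `--supports stmt-CriticalPhenomena-4575`); no definitions, named facts or sorries.
Companion `…HullPortSelectionThree.lean` assembles these into the conditional three-observer selection lemma.
Setting: bond percolation `μ = prodBernoulli w` on a finite vertex type, relays `A`, level `j`,
`R_v = {|π(v)| ≤ j}`; three observers `x₁, x₂, x₃`, a marker `z`; `U = C(x₁) ∪ C(x₂) ∪ C(x₃)`;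
`Θ'` = "the piece of `U` containing `z` is light if `z ∈ U`, else the piece of `x₁` is light" (so the census
event SL(3,1) of ttrl2 `sellemma`, with default `|π(U)| ≤ j`, is contained in `Θ'`).

PROVED HERE (memo `run/shared/lean/prim/prim-ineq-prove-5/SL3-PROOF.md` §6):
* `HullPort.zGlue_ratio_le` — `μ(z ∈ C₃, C₃ ∩ {x₁,x₂} = ∅) · μ(x₃ ∈ C₂, x₁ ∉ C₂) ≤ μ(C₃ ∩ {x₁,x₂} = ∅) · μ(z ∈ C₂, x₁ ∉ C₂)`
  (two applications of BHK Thm. 1.3; it says the mass-balance coefficient `λ` of the reduction is `≥ 0`);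
* `HullPort.cpa_marker_step` — `μ(A₃)·[μ(E₃ ∩ R₃) − μ(E₃ ∩ R₁)] ≤ μ(E₃)·[μ(A₃ ∩ R₃) − μ(A₃ ∩ R₁)]`,
  `A₃ = {C₃ ∩ {x₁,x₂} = ∅}`, `E₃ = A₃ ∩ {z ∈ C₃}` (BHK Thm. 1.3 with the avoidance SET `{x₁,x₂}`: the cluster form for
  `R₃` and the off-cluster form `setSep_offCluster_posCorrelation` for `R₁`);
(Both are unconditional; the conditional assembly `HullPort.selection_triple_of_markerDominance` is in the companion file.)
[cite: VandenbergHaggstromKahn2005, Thm. 1.3 (p. 6), Thm. 1.5 (p. 7) — corollaries via the tree's event forms]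
-/

noncomputable section

namespace Summit.CriticalPhenomena.PercolationContinuityZ3.Theorems

open MeasureTheory Set Literature.Probability.LatticeModels Literature.Probability.Percolation
open scoped Classical

variable {V : Type*}

namespace HullPort

open KNPreFKG LonelyClusterExchange TwoClusterExchange

/-! ### Event dictionaries -/

/-- `{ω | C_s(ω) ∈ connFamily s a} = {s ↔ a}`. [folklore] -/
theorem setOf_cluster_mem_connFamily (s a : V) :
    {ω : BondConfig V | openEdgeCluster ω s ∈ connFamily s a} = (openConn s a : Set (BondConfig V)) :=
  (openConn_eq_setOf_connFamily s a).symm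

/-- The family of edge sets whose vertex span from `s` carries at most `j` relays; a lower family. [folklore] -/
theorem isLowerSet_lightFamily (A : Finset V) (j : ℕ) (s : V) :
    IsLowerSet {C : Set (Sym2 V) | (A.filter fun t => t = s ∨ ∃ e ∈ C, t ∈ e).card ≤ j} := by
  intro C C' hCC' hC
  refine le_trans (Finset.card_le_card ?_) hC
  intro t ht
  rw [Finset.mem_filter] at ht ⊢
  refine ⟨ht.1, ?_⟩
  rcases ht.2 with h | ⟨e, he, hte⟩
  · exact Or.inl h
  · exact Or.inr ⟨e, hCC' he, hte⟩

/-- `{ω | C_s(ω) ∈ lightFamily} = R_s`. [folklore] -/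
theorem setOf_cluster_mem_lightFamily (A : Finset V) (j : ℕ) (s : V) :
    {ω : BondConfig V | openEdgeCluster ω s ∈
        {C : Set (Sym2 V) | (A.filter fun t => t = s ∨ ∃ e ∈ C, t ∈ e).card ≤ j}} =
      {ω : BondConfig V | (A.filter fun t => ω ∈ openConn s t).card ≤ j} := by
  ext ω
  simp only [mem_setOf_eq]
  have hf : (A.filter fun t => t = s ∨ ∃ e ∈ openEdgeCluster ω s, t ∈ e) =
      (A.filter fun t => ω ∈ openConn s t) := by
    refine Finset.filter_congr fun t _ => ?_
    rw [← reachable_iff_exists_mem_openEdgeCluster]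
    exact Iff.rfl
  rw [hf]

/-- The lightness event `R_s` is decreasing in the configuration. [folklore] -/
theorem isLowerSet_light (A : Finset V) (j : ℕ) (s : V) :
    IsLowerSet ({ω : BondConfig V | (A.filter fun t => ω ∈ openConn s t).card ≤ j} : Set (Set (Sym2 V))) := by
  intro ω ω' hle hω
  refine le_trans (Finset.card_le_card ?_) hω
  intro t ht
  rw [Finset.mem_filter] at ht ⊢
  exact ⟨ht.1, (ht.2 : (openGraph ω').Reachable s t).mono (openGraph_mono hle)⟩


/-! ### The mass-balance coefficient is nonnegative -/

/-- **`λ ≥ 0`.**  For distinct-enough vertices `x₁, x₂, x₃, z`: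
`μ(z ∈ C₃, C₃ ∌ x₁, x₂) · μ(x₁ ↮ x₂, x₂ ↔ x₃) ≤ μ(C₃ ∌ x₁, x₂) · μ(x₁ ↮ x₂, x₂ ↔ z)`
(two applications of BHK Thm. 1.3 for the cluster of `x₃` given `{x₃ ↮ x₁}`: `{z ∈ C₃}` is negatively
correlated with `{x₂ ∉ C₃}` and positively with `{x₂ ∈ C₃}`).
[cite: VandenbergHaggstromKahn2005, Thm. 1.3 (p. 6) — corollary] -/
theorem zGlue_ratio_le [Fintype V] (w : Sym2 V → unitInterval) (x₁ x₂ x₃ z : V) (h31 : x₃ ≠ x₁) :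
    (prodBernoulli w).real (((openConn x₃ x₁)ᶜ ∩ (openConn x₃ x₂)ᶜ) ∩ openConn x₃ z) *
      (prodBernoulli w).real ((openConn x₁ x₂)ᶜ ∩ openConn x₂ x₃) ≤
    (prodBernoulli w).real ((openConn x₃ x₁)ᶜ ∩ (openConn x₃ x₂)ᶜ) *
      (prodBernoulli w).real ((openConn x₁ x₂)ᶜ ∩ openConn x₂ z) := by
  set μ := prodBernoulli w with hμ
  have hs : x₃ ∉ ({x₁} : Set V) := by simpa using h31
  set D13 : Set (BondConfig V) := {ω | ∀ x ∈ ({x₁} : Set V), ¬ (openGraph ω).Reachable x₃ x} with hD13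
  set Z3 : Set (BondConfig V) := {ω | openEdgeCluster ω x₃ ∈ connFamily x₃ z} with hZ3
  set X3 : Set (BondConfig V) := {ω | openEdgeCluster ω x₃ ∈ connFamily x₃ x₂} with hX3
  set N3 : Set (BondConfig V) := {ω | openEdgeCluster ω x₃ ∈ disconnFamily x₃ ({x₂} : Set V)} with hN3
  -- (α) `{z ∈ C₃}` (up) against `{x₂ ∉ C₃}` (down), given `{x₃ ↮ x₁}`
  have hα := bhk_one_upper_lower w x₃ ({x₁} : Set V) hs (isUpperSet_connFamily x₃ z)
    (isLowerSet_disconnFamily x₃ ({x₂} : Set V))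
  -- (β) `{z ∈ C₃}` (up) with `{x₂ ∈ C₃}` (up), given `{x₃ ↮ x₁}`
  have hβ := bhk_one_upper_upper w x₃ ({x₁} : Set V) hs (isUpperSet_connFamily x₃ z)
    (isUpperSet_connFamily x₃ x₂)
  change μ.real D13 * μ.real (D13 ∩ (Z3 ∩ N3)) ≤ μ.real (D13 ∩ Z3) * μ.real (D13 ∩ N3) at hα
  change μ.real (D13 ∩ Z3) * μ.real (D13 ∩ X3) ≤ μ.real D13 * μ.real (D13 ∩ (Z3 ∩ X3)) at hβ
  -- dictionary
  have eZ3 : Z3 = (openConn x₃ z : Set (BondConfig V)) := setOf_cluster_mem_connFamily x₃ z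
  have eX3 : X3 = (openConn x₃ x₂ : Set (BondConfig V)) := setOf_cluster_mem_connFamily x₃ x₂
  have eN3 : N3 = (openConn x₃ x₂ : Set (BondConfig V))ᶜ := by
    rw [hN3, ← setOf_forall_not_reachable_eq]
    ext ω; simp only [mem_setOf_eq, mem_singleton_iff, forall_eq, mem_compl_iff]; exact Iff.rfl
  have eD13 : D13 = (openConn x₃ x₁ : Set (BondConfig V))ᶜ := by
    ext ω; simp only [hD13, mem_setOf_eq, mem_singleton_iff, forall_eq, mem_compl_iff]; exact Iff.rfl
  have e1 : ((openConn x₃ x₁ : Set (BondConfig V))ᶜ ∩ (openConn x₃ x₂)ᶜ) ∩ openConn x₃ z = D13 ∩ (Z3 ∩ N3) := by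
    rw [eD13, eZ3, eN3]; ext ω; simp only [mem_inter_iff, mem_compl_iff]; tauto
  have e2 : ((openConn x₃ x₁ : Set (BondConfig V))ᶜ ∩ (openConn x₃ x₂)ᶜ) = D13 ∩ N3 := by
    rw [eD13, eN3]
  have e3 : ((openConn x₁ x₂ : Set (BondConfig V))ᶜ ∩ openConn x₂ x₃) = D13 ∩ X3 := by
    rw [eD13, eX3]
    ext ω
    simp only [mem_inter_iff, mem_compl_iff]
    constructor
    · rintro ⟨h12, h23⟩
      have h23' : (openGraph ω).Reachable x₂ x₃ := h23
      refine ⟨fun h31' => h12 ?_, (h23'.symm : (openGraph ω).Reachable x₃ x₂)⟩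
      have h31'' : (openGraph ω).Reachable x₃ x₁ := h31'
      exact (h31''.symm.trans h23'.symm : (openGraph ω).Reachable x₁ x₂)
    · rintro ⟨h31', h32⟩
      have h32' : (openGraph ω).Reachable x₃ x₂ := h32
      refine ⟨fun h12 => h31' ?_, (h32'.symm : (openGraph ω).Reachable x₂ x₃)⟩
      have h12' : (openGraph ω).Reachable x₁ x₂ := h12
      exact (h32'.trans h12'.symm : (openGraph ω).Reachable x₃ x₁)
  have e4 : D13 ∩ (Z3 ∩ X3) ⊆ ((openConn x₁ x₂ : Set (BondConfig V))ᶜ ∩ openConn x₂ z) := by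
    rw [eD13, eZ3, eX3]
    rintro ω ⟨h31', h3z, h32⟩
    have h3z' : (openGraph ω).Reachable x₃ z := h3z
    have h32' : (openGraph ω).Reachable x₃ x₂ := h32
    refine ⟨fun h12 => h31' ?_, (h32'.symm.trans h3z' : (openGraph ω).Reachable x₂ z)⟩
    have h12' : (openGraph ω).Reachable x₁ x₂ := h12
    exact (h32'.trans h12'.symm : (openGraph ω).Reachable x₃ x₁)
  rw [e1, e2, e3]
  have hmono : μ.real (D13 ∩ (Z3 ∩ X3)) ≤ μ.real ((openConn x₁ x₂ : Set (BondConfig V))ᶜ ∩ openConn x₂ z) :=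
    measureReal_mono e4 (measure_ne_top _ _)
  have hA : 0 ≤ μ.real (D13 ∩ N3) := measureReal_nonneg
  have hX : 0 ≤ μ.real (D13 ∩ X3) := measureReal_nonneg
  have hZN : 0 ≤ μ.real (D13 ∩ (Z3 ∩ N3)) := measureReal_nonneg
  -- chain: μ(D13)·[μ(D13 Z3 N3) μ(D13 X3)] ≤ μ(D13 Z3) μ(D13 N3) μ(D13 X3) ≤ μ(D13)·[μ(D13 N3) μ(D13 Z3 X3)]
  have c1 : μ.real D13 * (μ.real (D13 ∩ (Z3 ∩ N3)) * μ.real (D13 ∩ X3)) ≤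
      μ.real (D13 ∩ Z3) * μ.real (D13 ∩ N3) * μ.real (D13 ∩ X3) := by
    have := mul_le_mul_of_nonneg_right hα hX
    linarith [this]
  have c2 : μ.real (D13 ∩ Z3) * μ.real (D13 ∩ N3) * μ.real (D13 ∩ X3) ≤
      μ.real D13 * (μ.real (D13 ∩ N3) * μ.real (D13 ∩ (Z3 ∩ X3))) := by
    have := mul_le_mul_of_nonneg_right hβ hA
    linarith [this]
  by_cases h0 : μ.real D13 = 0
  · have hsub : μ.real (D13 ∩ (Z3 ∩ N3)) ≤ μ.real D13 := measureReal_mono inter_subset_left (measure_ne_top _ _)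
    have hz : μ.real (D13 ∩ (Z3 ∩ N3)) = 0 := le_antisymm (by rw [h0] at hsub; exact hsub) hZN
    rw [hz, zero_mul]
    exact mul_nonneg hA measureReal_nonneg
  · have hpos : 0 < μ.real D13 := lt_of_le_of_ne measureReal_nonneg (Ne.symm h0)
    have c3 : μ.real (D13 ∩ (Z3 ∩ N3)) * μ.real (D13 ∩ X3) ≤ μ.real (D13 ∩ N3) * μ.real (D13 ∩ (Z3 ∩ X3)) :=
      le_of_mul_le_mul_left (c1.trans c2) hpos
    exact c3.trans (mul_le_mul_of_nonneg_left hmono hA)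


/-! ### The CPA step for the third observer's cluster, avoidance set `{x₁, x₂}` -/

/-- **CPA step.**  With `A₃ = {x₃ ↮ x₁, x₃ ↮ x₂}`, `E₃ = A₃ ∩ {x₃ ↔ z}` and the lightness events `R₃`, `R₁`:
`μ(A₃)·(μ(E₃ ∩ R₃) − μ(E₃ ∩ R₁)) ≤ μ(E₃)·(μ(A₃ ∩ R₃) − μ(A₃ ∩ R₁))`.  Given `A₃`, `{z ∈ C₃}` is an increasing
event of the cluster of `x₃`, `R₃` a decreasing one (BHK Thm. 1.3), and `R₁` a decreasing statistic read off the
configuration outside `W̄(C₃)` (`setSep_offCluster_posCorrelation`).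
[cite: VandenbergHaggstromKahn2005, Thm. 1.3 (p. 6) and pp. 7–8 — corollary] -/
theorem cpa_marker_step [Fintype V] (w : Sym2 V → unitInterval) (A : Finset V) (j : ℕ) (x₁ x₂ x₃ z : V)
    (h31 : x₃ ≠ x₁) (h32 : x₃ ≠ x₂) :
    (prodBernoulli w).real {ω : BondConfig V | ∀ x ∈ ({x₁, x₂} : Set V), ¬ (openGraph ω).Reachable x₃ x} *
      ((prodBernoulli w).real (({ω : BondConfig V | ∀ x ∈ ({x₁, x₂} : Set V), ¬ (openGraph ω).Reachable x₃ x} ∩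
          openConn x₃ z) ∩ {ω : BondConfig V | (A.filter fun t => ω ∈ openConn x₃ t).card ≤ j}) -
        (prodBernoulli w).real (({ω : BondConfig V | ∀ x ∈ ({x₁, x₂} : Set V), ¬ (openGraph ω).Reachable x₃ x} ∩
          openConn x₃ z) ∩ {ω : BondConfig V | (A.filter fun t => ω ∈ openConn x₁ t).card ≤ j})) ≤
    (prodBernoulli w).real ({ω : BondConfig V | ∀ x ∈ ({x₁, x₂} : Set V), ¬ (openGraph ω).Reachable x₃ x} ∩
        openConn x₃ z) *
      ((prodBernoulli w).real ({ω : BondConfig V | ∀ x ∈ ({x₁, x₂} : Set V), ¬ (openGraph ω).Reachable x₃ x} ∩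
          {ω : BondConfig V | (A.filter fun t => ω ∈ openConn x₃ t).card ≤ j}) -
        (prodBernoulli w).real ({ω : BondConfig V | ∀ x ∈ ({x₁, x₂} : Set V), ¬ (openGraph ω).Reachable x₃ x} ∩
          {ω : BondConfig V | (A.filter fun t => ω ∈ openConn x₁ t).card ≤ j})) := by
  set μ := prodBernoulli w with hμ
  have hs : x₃ ∉ ({x₁, x₂} : Set V) := by
    simp only [mem_insert_iff, mem_singleton_iff, not_or]; exact ⟨h31, h32⟩
  set DX : Set (BondConfig V) := {ω | ∀ x ∈ ({x₁, x₂} : Set V), ¬ (openGraph ω).Reachable x₃ x} with hDX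
  set Z3 : Set (BondConfig V) := {ω | openEdgeCluster ω x₃ ∈ connFamily x₃ z} with hZ3
  set R3 : Set (BondConfig V) := {ω | (A.filter fun t => ω ∈ openConn x₃ t).card ≤ j} with hR3
  set R1 : Set (BondConfig V) := {ω | (A.filter fun t => ω ∈ openConn x₁ t).card ≤ j} with hR1
  have eZ3 : Z3 = (openConn x₃ z : Set (BondConfig V)) := setOf_cluster_mem_connFamily x₃ z
  -- (1a) cluster form of Thm 1.3: `μ(DX)·μ(DX ∩ Z3 ∩ R3) ≤ μ(DX ∩ Z3)·μ(DX ∩ R3)`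
  have h1a := bhk_one_upper_lower w x₃ ({x₁, x₂} : Set V) hs (isUpperSet_connFamily x₃ z)
    (isLowerSet_lightFamily A j x₃)
  rw [setOf_cluster_mem_lightFamily A j x₃] at h1a
  change μ.real DX * μ.real (DX ∩ (Z3 ∩ R3)) ≤ μ.real (DX ∩ Z3) * μ.real (DX ∩ R3) at h1a
  -- (1b) off-cluster form: `μ(DX ∩ Z3)·μ(DX ∩ R1) ≤ μ(DX)·μ(DX ∩ Z3 ∩ R1)`
  have hG : Antitone (R1.indicator (1 : BondConfig V → ℝ)) :=
    antitone_indicator_one_of_isLowerSet (isLowerSet_light A j x₁)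
  have hloc : ∀ ω : BondConfig V, (∀ x ∈ ({x₁, x₂} : Set V), ¬ (openGraph ω).Reachable x₃ x) →
      R1.indicator (1 : BondConfig V → ℝ)
        (ω \ {e | ∃ v ∈ e, v = x₃ ∨ ∃ e' ∈ openEdgeCluster ω x₃, v ∈ e'}) = R1.indicator 1 ω := by
    intro ω hω
    have hx : ¬ (openGraph ω).Reachable x₃ x₁ := hω x₁ (by simp)
    have hf : (A.filter fun t => (ω \ {e | ∃ v ∈ e, v = x₃ ∨ ∃ e' ∈ openEdgeCluster ω x₃, v ∈ e'}) ∈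
        openConn x₁ t) = (A.filter fun t => ω ∈ openConn x₁ t) :=
      Finset.filter_congr fun t _ => LonePortSumGeneral.reachable_sdiff_bar_iff hx t
    have hmem : (ω \ {e | ∃ v ∈ e, v = x₃ ∨ ∃ e' ∈ openEdgeCluster ω x₃, v ∈ e'}) ∈ R1 ↔ ω ∈ R1 := by
      simp only [hR1, mem_setOf_eq, hf]
    by_cases hω1 : ω ∈ R1
    · rw [indicator_of_mem hω1, indicator_of_mem (hmem.2 hω1), Pi.one_apply, Pi.one_apply]
    · rw [indicator_of_notMem hω1, indicator_of_notMem (fun h => hω1 (hmem.1 h))]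
  have h1b := setSep_offCluster_posCorrelation w x₃ ({x₁, x₂} : Set V) hs
    ((connFamily x₃ z).indicator 1) (monotone_indicator_one_of_isUpperSet (isUpperSet_connFamily x₃ z))
    (R1.indicator 1) hG hloc
  rw [show (fun ω : BondConfig V => (connFamily x₃ z).indicator (1 : Set (Sym2 V) → ℝ) (openEdgeCluster ω x₃) *
      R1.indicator 1 ω) = (Z3 ∩ R1).indicator 1 by
    rw [← indicator_one_mul_indicator_one]
    funext ω
    rw [← indicator_comp_openEdgeCluster],
    indicator_comp_openEdgeCluster, setIntegral_indicator_one_eq, setIntegral_indicator_one_eq,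
    setIntegral_indicator_one_eq] at h1b
  change μ.real (DX ∩ Z3) * μ.real (DX ∩ R1) ≤ μ.real DX * μ.real (DX ∩ (Z3 ∩ R1)) at h1b
  -- assemble
  have e1 : (DX ∩ openConn x₃ z) ∩ R3 = DX ∩ (Z3 ∩ R3) := by rw [eZ3, inter_assoc]
  have e2 : (DX ∩ openConn x₃ z) ∩ R1 = DX ∩ (Z3 ∩ R1) := by rw [eZ3, inter_assoc]
  have e3 : DX ∩ openConn x₃ z = DX ∩ Z3 := by rw [eZ3]
  rw [e1, e2, e3]
  nlinarith [h1a, h1b]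


end HullPort

end Summit.CriticalPhenomena.PercolationContinuityZ3.Theorems

end
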